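import Mathlib
import HarnessLib
import Summits.Langlands.Langlands.Statement
import Literature.NumberTheory.GaloisRepresentations.LocalGaloisGroupFrobeniusProofs
import Literature.NumberTheory.Automorphic.LocalConstantsProofs
import Literature.NumberTheory.Automorphic.LocalLanglandsGLProofs
import Summits.Langlands.Langlands.Theorems.IrreducibilityBySelfDualityReciprocityUpToIrreducibilityCorrespondsConj
import Summits.Langlands.Langlands.Theorems.IrreducibilityBySelfDualityReciprocityUpToIrreducibilityWeakAutomorphyOfFontaineMazur
import Literature.NumberTheory.GaloisRepresentations.AbsGaloisGroupProofs
import Literature.NumberTheory.Automorphic.GLnAdelicStructureProofs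

/-!
# Crux `ReciprocityTRCM` (item stmt-Langlands-1093), line `pieces`: tightness of the registered stub
# `stub_potentialAutomorphyCM` — it is implied by the piece `X₂ = WeakGalToAutCM` it serves, and by
# lang.S03 (Fontaine–Mazur–Langlands) at the pinned datum

Support file (closes nothing).  The registered stub `stub_potentialAutomorphyCM` of
`Cruxes/ReciprocityTRCM/Lines/pieces.lean` (POTENTIAL weak automorphy over CM fields: for a CM field
`F`, a reciprocity datum `R` carrying direction (A) in every rank, and an irreducible `R`-geometric
`ρ : Γ_F → GL_n(ℚ̄_ℓ)`, there are a finite Galois `F'/F` on which `ρ` stays irreducible and an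
L-algebraic cuspidal `π'` of `GL_n(𝔸_{F'})` Satake–Frobenius compatible with `ρ|_{Γ_{F'}}` at almost
all places) is the open conjecture "potential Fontaine–Mazur–Langlands over CM fields" (known only in
the regular / big-residual-image sectors: BLGGT Thm. 4.5.1, ACC+ Thm. 6.1.1, Qian Thm. 1.4).  This file
records, kernel-checked, that the cut `X₂ = stub_potentialAutomorphyCM ∘ stub_descentOfAutomorphy`
of the line is NOT lossy:

* `stub_potentialAutomorphyCM_of_weakGalToAutCM` — the piece `X₂ = WeakGalToAutCM` (weak direction
  (B) over CM fields for every datum carrying (A), written out verbatim: Theorems files do not import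
  the Cruxes skeleton) implies the stub, with `F' := F`;
* `stub_potentialAutomorphyCM_of_fontaineMazurLanglandsGLn` — so does the accepted named text lang.S03
  `FontaineMazurLanglandsGLn` (all ranks) at the summit's PINNED `p`-adic Hodge datum, through the
  landed `ReciprocityUpToIrreducibility.stub_weakAutomorphy_of_fontaineMazurLanglandsGLn` (B_w from
  lang.S03); neither the CM hypothesis nor (A) is used on that path.

The only non-trivial point of `F' := F` is that the tree's restriction `ρ.restrictField F = ρ ∘ res`,
`res = absGaloisRestrict F F : Γ_F →ₜ* Γ_F`, is NOT the identity: it is restriction along the chosen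
embedding `absClosureEmbedding F F = IsAlgClosed.lift : F̄ → F̄`, an arbitrary `F`-automorphism `τ` of
`F̄`, so `res = Inn(τ⁻¹)` (`exists_absGaloisRestrict_self_eq_conj`, from the landed
`absGaloisRestrict_isConj_of_algHom_holds`).  Hence `ρ.restrictField F = ρ(τ)⁻¹ ρ ρ(τ)` is a change of
frame of `ρ` (`isConjugate_restrictField_self`), irreducibility is unchanged
(`isIrreducible_restrictField_self_iff`, `res` being surjective) and so is Satake–Frobenius
compatibility (`satakeFrobCompatibleAt_restrictField_self`, by the landed `satakeFrobCompatibleAt_conj`).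
The pointwise form `potentialWeakAutomorphy_self` (weak automorphy of `ρ` over `F` itself gives the
stub's `∃ F'` conclusion) is the reusable lemma.  No definitions; std axioms.
(buildfix 2026-08-20: comment-only re-land to re-enqueue the module build after its blocking imports were repaired; no declaration changed.)
-/

noncomputable section

set_option linter.dupNamespace false -- project-wide option (lakefile weak.linter.dupNamespace); `Summit.Langlands.Langlands` is the mandated namespace

open scoped MatrixGroups NumberField Classical
open Filter IsDedekindDomain Field
open Literature.NumberTheory.Automorphic Literature.NumberTheory.GaloisRepresentations
open Summit.Langlands

namespace Summit.Langlands.Langlands.Theorems.ReciprocityTRCM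

/-! ## 1. Restriction along the identity `F → F` is an inner automorphism of `Γ_F` -/

section SelfRestriction

/-- **`res : Γ_K → Γ_K` along the identity of `K` is inner.**  The tree's restriction map
`absGaloisRestrict K K` restricts automorphisms of `K̄` along the CHOSEN `K`-embedding
`absClosureEmbedding K K = IsAlgClosed.lift : K̄ → K̄`, which is some `τ ∈ Gal(K̄/K)`; so
`res σ = τ⁻¹ σ τ`.  (Instance of the landed independence-of-the-embedding-up-to-conjugacy
`absGaloisRestrict_isConj_of_algHom_holds` at the identity embedding and the identity map.)
[cite: MilneFT2022, Ch. 7 (the absolute Galois group is defined up to an inner automorphism)] -/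
theorem exists_absGaloisRestrict_self_eq_conj (K : Type*) [Field K] :
    ∃ τ : absoluteGaloisGroup K, ∀ σ : absoluteGaloisGroup K,
      absGaloisRestrict K K σ = τ⁻¹ * σ * τ := by
  obtain ⟨τ, hτ⟩ := absGaloisRestrict_isConj_of_algHom_holds K K
    (AlgHom.id K (AlgebraicClosure K)) id (fun _ _ => rfl)
  refine ⟨τ, fun σ => ?_⟩
  have h : σ = τ * absGaloisRestrict K K σ * τ⁻¹ := hτ σ
  calc absGaloisRestrict K K σ
      = τ⁻¹ * (τ * absGaloisRestrict K K σ * τ⁻¹) * τ := by group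
    _ = τ⁻¹ * σ * τ := by rw [← h]

/-- `res : Γ_K → Γ_K` along the identity of `K` is surjective (it is an inner automorphism).
[folklore] -/
theorem absGaloisRestrict_self_surjective (K : Type*) [Field K] :
    Function.Surjective (absGaloisRestrict K K) := by
  obtain ⟨τ, hτ⟩ := exists_absGaloisRestrict_self_eq_conj K
  exact fun g => ⟨τ * g * τ⁻¹, by rw [hτ]; group⟩

variable {K : Type} [Field K] {n : ℕ} {ℓ : ℕ} [Fact ℓ.Prime]

/-- **`ρ|_{Γ_K}` along the identity `K → K` is a change of frame of `ρ`**: with `res = Inn(τ⁻¹)`,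
`ρ (res σ) = ρ(τ)⁻¹ ρ(σ) ρ(τ)`, i.e. `ρ.restrictField K = FramedRep.conj (ρ τ)⁻¹ ρ`. [folklore] -/
theorem isConjugate_restrictField_self (ρ : FramedGaloisRep K (PadicAlgCl ℓ) n) :
    IsConjugate ρ (ρ.restrictField K) := by
  obtain ⟨τ, hτ⟩ := exists_absGaloisRestrict_self_eq_conj K
  refine ⟨(ρ τ)⁻¹, ?_⟩
  ext σ : 1
  rw [FramedRep.conj_apply, FramedGaloisRep.restrictField_apply, hτ, map_mul, map_mul, map_inv,
    inv_inv]

/-- Irreducibility is unchanged by restriction along the identity `K → K` (`res` is surjective, so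
`ρ ∘ res` and `ρ` have the same stable subspaces). [folklore] -/
theorem isIrreducible_restrictField_self_iff (ρ : FramedGaloisRep K (PadicAlgCl ℓ) n) :
    (ρ.restrictField K).toGaloisRep.IsIrreducible ↔ ρ.toGaloisRep.IsIrreducible := by
  have hsurj := absGaloisRestrict_self_surjective K
  have hrep : (ρ.restrictField K).toGaloisRep.toRepresentation =
      ρ.toGaloisRep.toRepresentation.comp
        (absGaloisRestrict K K : absoluteGaloisGroup K →* absoluteGaloisGroup K) :=
    MonoidHom.ext fun _ => rfl
  change Representation.IsIrreducible (ρ.restrictField K).toGaloisRep.toRepresentation ↔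
    Representation.IsIrreducible ρ.toGaloisRep.toRepresentation
  rw [hrep]
  let e : Subrepresentation (ρ.toGaloisRep.toRepresentation.comp
      (absGaloisRestrict K K : absoluteGaloisGroup K →* absoluteGaloisGroup K)) ≃o
      Subrepresentation ρ.toGaloisRep.toRepresentation :=
    { toFun := fun W => ⟨W.toSubmodule, fun g v hv => by
        obtain ⟨h, rfl⟩ := hsurj g
        exact W.apply_mem_toSubmodule h hv⟩
      invFun := fun W => ⟨W.toSubmodule, fun h v hv =>
        W.apply_mem_toSubmodule (absGaloisRestrict K K h) hv⟩
      left_inv := fun _ => rfl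
      right_inv := fun _ => rfl
      map_rel_iff' := Iff.rfl }
  exact e.isSimpleOrder_iff

variable [NumberField K] {hcpt : isCompact_glFiniteIntegralLevel n K}

/-- Satake–Frobenius compatibility at `v` passes to the restriction along the identity `K → K`
(a change of frame, `satakeFrobCompatibleAt_conj`). [cite: SerreAbelianLadic1968, Ch. I §2.3] -/
theorem satakeFrobCompatibleAt_restrictField_self (ι : PadicAlgCl ℓ ≃+* ℂ)
    (π : AutomorphicRepData (AutomorphyDatum.gl n K hcpt)) {ρ : FramedGaloisRep K (PadicAlgCl ℓ) n}
    {v : HeightOneSpectrum (𝓞 K)} (h : SatakeFrobCompatibleAt ι π ρ v) :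
    SatakeFrobCompatibleAt ι π (ρ.restrictField K) v := by
  obtain ⟨P, hP⟩ := isConjugate_restrictField_self ρ
  rw [← hP]
  exact ReciprocityUpToIrreducibility.satakeFrobCompatibleAt_conj ι π P h

/-- **Weak automorphy over `F` itself is potential weak automorphy with `F' := F`.**  If the
irreducible `ρ : Γ_F → GL_n(ℚ̄_ℓ)` is Satake–Frobenius compatible at almost all places with an
L-algebraic cuspidal `π` of `GL_n(𝔸_F)`, then the conclusion of `stub_potentialAutomorphyCM` holds
with the witness `F' := F` (`Algebra.id`, `IsGalois.self`): `ρ|_{Γ_F}` (restriction along the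
identity, a change of frame of `ρ`) is irreducible and a.e. compatible with the same `π`.
[folklore] -/
theorem potentialWeakAutomorphy_self (ι : PadicAlgCl ℓ ≃+* ℂ) (ρ : FramedGaloisRep K (PadicAlgCl ℓ) n)
    (hirr : ρ.toGaloisRep.IsIrreducible) (π : CuspidalAutomorphicRepData n K hcpt)
    (hL : π.1.IsLAlgebraic)
    (hsat : ∀ᶠ v : HeightOneSpectrum (𝓞 K) in cofinite, SatakeFrobCompatibleAt ι π.1 ρ v) :
    ∃ (F' : Type) (_ : Field F') (_ : NumberField F') (_ : Algebra K F') (_ : IsGalois K F'),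
      (ρ.restrictField F').toGaloisRep.IsIrreducible ∧
        ∃ (hcpt' : isCompact_glFiniteIntegralLevel n F') (π' : CuspidalAutomorphicRepData n F' hcpt'),
          π'.1.IsLAlgebraic ∧ ∀ᶠ w : HeightOneSpectrum (𝓞 F') in cofinite,
            SatakeFrobCompatibleAt ι π'.1 (ρ.restrictField F') w :=
  ⟨K, inferInstance, inferInstance, inferInstance, IsGalois.self K,
    (isIrreducible_restrictField_self_iff ρ).2 hirr, hcpt, π, hL,
    hsat.mono fun _ hv => satakeFrobCompatibleAt_restrictField_self ι π.1 hv⟩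

end SelfRestriction

/-! ## 2. The stub from the piece `X₂ = WeakGalToAutCM`, and from lang.S03 at the pinned datum -/

/-- **Tightness of the cut of `X₂`: the piece `X₂ = WeakGalToAutCM` implies the registered stub
`stub_potentialAutomorphyCM` (signature verbatim).**  The hypothesis is the body of
`Cruxes.ReciprocityTRCM.Pieces.WeakGalToAutCM` written out (weak direction (B) over CM fields for
every reciprocity datum carrying (A)); the conclusion is the stub, witnessed by `F' := F`
(`potentialWeakAutomorphy_self`, with `hcpt := isCompact_glFiniteIntegralLevel_holds n F`).  So the
line's cut `X₂ = stub_potentialAutomorphyCM → stub_descentOfAutomorphy → X₂` loses nothing on its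
first factor. [cite: FontaineMazurGeometric1995, Conj. 1] -/
theorem stub_potentialAutomorphyCM_of_weakGalToAutCM : (∀ (F : Type) [Field F] [NumberField F], NumberField.IsCMField F → ∀ R : ReciprocityData F, (∀ n : ℕ, 0 < n → ∀ hcpt : Literature.NumberTheory.Automorphic.isCompact_glFiniteIntegralLevel n F, AutomorphicToGalois n R hcpt) → ∀ (n : ℕ), 0 < n → ∀ (ℓ : ℕ) [Fact ℓ.Prime] (ι : PadicAlgCl ℓ ≃+* ℂ) (ρ : Literature.NumberTheory.GaloisRepresentations.FramedGaloisRep F (PadicAlgCl ℓ) n), ρ.toGaloisRep.IsIrreducible → IsGeometricFramed R ρ → ∀ hcpt : Literature.NumberTheory.Automorphic.isCompact_glFiniteIntegralLevel n F, ∃ π : Literature.NumberTheory.Automorphic.CuspidalAutomorphicRepData n F hcpt, π.1.IsLAlgebraic ∧ ∀ᶠ v : IsDedekindDomain.HeightOneSpectrum (NumberField.RingOfIntegers F) in cofinite, SatakeFrobCompatibleAt ι π.1 ρ v) → ∀ (F : Type) [Field F] [NumberField F], NumberField.IsCMField F → ∀ R : ReciprocityData F, (∀ n : ℕ, 0 <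 n → ∀ hcpt : Literature.NumberTheory.Automorphic.isCompact_glFiniteIntegralLevel n F, AutomorphicToGalois n R hcpt) → ∀ (n : ℕ), 0 < n → ∀ (ℓ : ℕ) [Fact ℓ.Prime] (ι : PadicAlgCl ℓ ≃+* ℂ) (ρ : Literature.NumberTheory.GaloisRepresentations.FramedGaloisRep F (PadicAlgCl ℓ) n), ρ.toGaloisRep.IsIrreducible → IsGeometricFramed R ρ → ∃ (F' : Type) (_ : Field F') (_ : NumberField F') (_ : Algebra F F') (_ : IsGalois F F'), (ρ.restrictField F').toGaloisRep.IsIrreducible ∧ ∃ (hcpt' : Literature.NumberTheory.Automorphic.isCompact_glFiniteIntegralLevel n F') (π' : Literature.NumberTheory.Automorphic.CuspidalAutomorphicRepData n F' hcpt'), π'.1.IsLAlgebraic ∧ ∀ᶠ w : IsDedekindDomain.HeightOneSpectrum (NumberField.RingOfIntegers F') in cofinite, SatakeFrobCompatibleAt ι π'.1 (ρ.restrictField F') w := by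
  intro hX₂ F _ _ hF R hA n hn ℓ _ ι ρ hirr hgeo
  obtain ⟨π, hL, hsat⟩ :=
    hX₂ F hF R hA n hn ℓ ι ρ hirr hgeo (isCompact_glFiniteIntegralLevel_holds n F)
  exact potentialWeakAutomorphy_self ι ρ hirr π hL hsat

/-- **The stub from lang.S03 at the pinned datum.**  If the accepted Fontaine–Mazur–Langlands text
`FontaineMazurLanglandsGLn 𝔅 n` holds in every rank `n` for the summit's pinned family
`𝔅 K ℓ v hv := ⟨(fontainePstAdicCompletion v ℓ hv).algebra, (fontainePstAdicCompletion v ℓ hv).𝔅⟩`,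
then `stub_potentialAutomorphyCM` holds (signature verbatim): B_w over `F` by the landed
`ReciprocityUpToIrreducibility.stub_weakAutomorphy_of_fontaineMazurLanglandsGLn` (the hypothesis
`IsGeometricFramed R ρ` IS pinned-geometricity, `ReciprocityData.pst` ignoring `R`), then `F' := F`.
The CM hypothesis and (A) are not used. [cite: FontaineMazurGeometric1995, Conj. 1]
[cite: BuzzardGeeLMS2014, Conj. 3.2.2] -/
theorem stub_potentialAutomorphyCM_of_fontaineMazurLanglandsGLn :
    (∀ n : ℕ, FontaineMazurLanglandsGLn
      (fun (K : Type) [Field K] [NumberField K] (ℓ : ℕ) [Fact ℓ.Prime]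
          (v : HeightOneSpectrum (𝓞 K)) (hv : ((ℓ : ℕ) : 𝓞 K) ∈ v.asIdeal) =>
        ⟨(Literature.NumberTheory.PAdicHodge.fontainePstAdicCompletion v ℓ hv).algebra,
          (Literature.NumberTheory.PAdicHodge.fontainePstAdicCompletion v ℓ hv).𝔅⟩) n) →
    ∀ (F : Type) [Field F] [NumberField F], NumberField.IsCMField F → ∀ R : ReciprocityData F, (∀ n : ℕ, 0 < n → ∀ hcpt : Literature.NumberTheory.Automorphic.isCompact_glFiniteIntegralLevel n F, AutomorphicToGalois n R hcpt) → ∀ (n : ℕ), 0 < n → ∀ (ℓ : ℕ) [Fact ℓ.Prime] (ι : PadicAlgCl ℓ ≃+* ℂ) (ρ : Literature.NumberTheory.GaloisRepresentations.FramedGaloisRep F (PadicAlgCl ℓ) n), ρ.toGaloisRep.IsIrreducible → IsGeometricFramed R ρ → ∃ (F' : Type) (_ : Field F') (_ : NumberField F') (_ : Algebra F F') (_ : IsGalois F F'), (ρ.restrictField F').toGaloisRep.IsIrreducible ∧ ∃ (hcpt' : Literature.NumberTheory.Automorphic.isCompact_glFiniteIntegralLevel n F') (π' : Literature.NumberTheory.Automorphic.CuspidalAutomorphicRepData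 n F' hcpt'), π'.1.IsLAlgebraic ∧ ∀ᶠ w : IsDedekindDomain.HeightOneSpectrum (NumberField.RingOfIntegers F') in cofinite, SatakeFrobCompatibleAt ι π'.1 (ρ.restrictField F') w := by
  intro hS03 F _ _ _hF R _hA n hn ℓ _ ι ρ hirr hgeo
  obtain ⟨π, hL, hsat⟩ :=
    ReciprocityUpToIrreducibility.stub_weakAutomorphy_of_fontaineMazurLanglandsGLn hS03 F n
      (isCompact_glFiniteIntegralLevel_holds n F) hn ℓ ι ρ hirr hgeo
  exact potentialWeakAutomorphy_self ι ρ hirr π hL hsat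

end Summit.Langlands.Langlands.Theorems.ReciprocityTRCM

end
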